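import Mathlib
import Literature.NumberTheory.LFunctions.MoebiusAutomatic
import Literature.NumberTheory.LFunctions.AutomaticSequenceClosure
import Literature.NumberTheory.LFunctions.MoebiusAutomaticReductions
import Literature.NumberTheory.LFunctions.SiegelWalfiszLiouville
import Literature.NumberTheory.LFunctions.LiouvilleCharSumLinnikBox

/-!
# Automatic sequences are orthogonal to the Liouville function, from Müllner's Möbius theorem

Helper for crux `Summit.QuantumAdvantage.QuantumAdvantage.Theses.MobiusLadder.DigitPolyUniformity`
(item stmt-QuantumAdvantage-1392, line Sketch): the Liouville variant of the named fact
`Literature.NumberTheory.LFunctions.mullner_moebius_automatic` (Müllner 2017, Thm. 1.2: every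
`k`-automatic sequence `a`, `k ≥ 2`, has `∑_{n ≤ N} a(n) μ(n) = o(N)`). We prove

* `liouville_automatic_of_mullner`: assuming that fact, for every `k ≥ 2`, every `k`-automatic
  `a : ℕ → ℂ` and every `ε > 0`, `‖∑_{n ≤ N} a(n) λ(n)‖ ≤ ε N` for all large `N`.

## Proof

`λ = 𝟙_□ ⋆ μ`, so `∑_{n ≤ N} a(n) λ(n) = ∑_{1 ≤ d ≤ √N} ∑_{m ≤ N/d²} a(d² m) μ(m)`
(`LiouvilleAutomatic.sum_mul_liouville_eq`, from the tree's `liouville_eq_sum_antidiagonal_complex`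
and Dirichlet's rearrangement `sum_Ioc_sum_divisorsAntidiagonal_eq`). Each subsequence `m ↦ a(d² m)`
is again `k`-automatic (`IsAutomaticSeq.linearSubseq`), so Müllner's theorem bounds the inner sum
by `(ε/6) · N/d²` once `N/d² ≥ N₁(d)`, and trivially by `B · N₁(d)` otherwise (`‖a‖ ≤ B`, a
`k`-automatic sequence having finite range). Summing `1/d² ≤ 2` over `d ≤ D` and `∑_{d > D} 1/d²
≤ 1/D` for the trivial bound `B N/d²` of the remaining terms gives
`‖∑‖ ≤ (ε/3) N + B ∑_{d ≤ D} N₁(d) + (B/D) N ≤ ε N` for `B/D ≤ ε/3` and `N` large.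
-/

set_option linter.dupNamespace false -- D-0017: single-problem summit ⇒ QuantumAdvantage.QuantumAdvantage by design

namespace Summit.QuantumAdvantage.QuantumAdvantage.Theorems.MobiusLadder

open Finset ArithmeticFunction
open scoped ArithmeticFunction.Moebius
open Literature.NumberTheory.LFunctions (IsAutomaticSeq mullner_moebius_automatic
  norm_moebius_cast_le_one)
open Literature.NumberTheory.LFunctions.SiegelWalfiszLiouville (sum_Ioc_sum_divisorsAntidiagonal_eq
  sum_Ioc_inv_sq_le sum_Ioc_inv_sq_le_two filter_isSquare_Ioc_eq_image)
open Literature.NumberTheory.LFunctions.LiouvilleCharSumLinnikBox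
  (liouville_eq_sum_antidiagonal_complex)

namespace LiouvilleAutomatic

/-- `∑_{n < M + 1} f(n) = ∑_{0 < n ≤ M} f(n)` when `f(0) = 0`. [folklore] -/
theorem sum_range_succ_eq_sum_Ioc {f : ℕ → ℂ} (hf : f 0 = 0) (M : ℕ) :
    ∑ n ∈ range (M + 1), f n = ∑ n ∈ Ioc 0 M, f n := by
  symm
  refine sum_subset (fun n hn => ?_) (fun n hn hn' => ?_)
  · rw [mem_Ioc] at hn
    rw [mem_range]
    omega
  · rw [mem_range] at hn
    rw [mem_Ioc] at hn'
    obtain rfl : n = 0 := by omega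
    exact hf

/-- **Dirichlet's rearrangement of `λ = 𝟙_□ ⋆ μ` against a weight:**
`∑_{0 < n ≤ N} a(n) λ(n) = ∑_{0 < d ≤ √N} ∑_{0 < m ≤ N/d²} a(d² m) μ(m)`. [folklore] -/
theorem sum_mul_liouville_eq (a : ℕ → ℂ) (N : ℕ) :
    ∑ n ∈ Ioc 0 N, a n * (liouville n : ℂ) =
      ∑ d ∈ Ioc 0 (Nat.sqrt N), ∑ m ∈ Ioc 0 (N / (d * d)), a (d * d * m) * (μ m : ℂ) := by
  have h1 : ∀ n ∈ Ioc 0 N, a n * (liouville n : ℂ) =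
      ∑ x ∈ n.divisorsAntidiagonal,
        (if IsSquare x.1 then (1 : ℂ) else 0) * (a (x.1 * x.2) * (μ x.2 : ℂ)) := by
    intro n _
    rw [liouville_eq_sum_antidiagonal_complex, mul_sum]
    refine sum_congr rfl fun x hx => ?_
    rw [Nat.mem_divisorsAntidiagonal] at hx
    rw [hx.1]
    ring
  have h2 : ∀ s ∈ Ioc 0 N,
      ∑ m ∈ Ioc 0 (N / s), (if IsSquare s then (1 : ℂ) else 0) * (a (s * m) * (μ m : ℂ)) =
        if IsSquare s then ∑ m ∈ Ioc 0 (N / s), a (s * m) * (μ m : ℂ) else 0 := by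
    intro s _
    by_cases hs : IsSquare s
    · simp only [if_pos hs, one_mul]
    · simp only [if_neg hs, zero_mul, sum_const_zero]
  calc ∑ n ∈ Ioc 0 N, a n * (liouville n : ℂ)
      = ∑ n ∈ Ioc 0 N, ∑ x ∈ n.divisorsAntidiagonal,
          (if IsSquare x.1 then (1 : ℂ) else 0) * (a (x.1 * x.2) * (μ x.2 : ℂ)) :=
        sum_congr rfl h1
    _ = ∑ s ∈ Ioc 0 N, ∑ m ∈ Ioc 0 (N / s),
          (if IsSquare s then (1 : ℂ) else 0) * (a (s * m) * (μ m : ℂ)) :=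
        sum_Ioc_sum_divisorsAntidiagonal_eq
          (fun s m => (if IsSquare s then (1 : ℂ) else 0) * (a (s * m) * (μ m : ℂ))) N
    _ = ∑ s ∈ Ioc 0 N, if IsSquare s then ∑ m ∈ Ioc 0 (N / s), a (s * m) * (μ m : ℂ) else 0 :=
        sum_congr rfl h2
    _ = ∑ s ∈ (Ioc 0 N).filter IsSquare, ∑ m ∈ Ioc 0 (N / s), a (s * m) * (μ m : ℂ) :=
        (sum_filter _ _).symm
    _ = ∑ d ∈ Ioc 0 (Nat.sqrt N), ∑ m ∈ Ioc 0 (N / (d * d)), a (d * d * m) * (μ m : ℂ) := by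
        rw [filter_isSquare_Ioc_eq_image, sum_image]
        intro x _ y _ hxy
        exact Nat.mul_self_inj.mp hxy

/-- The trivial bound `‖∑_{0 < m ≤ M} f(m) μ(m)‖ ≤ B M` for `‖f‖ ≤ B` (`|μ| ≤ 1`). [folklore] -/
theorem norm_sum_Ioc_mul_moebius_le {f : ℕ → ℂ} {B : ℝ} (hf : ∀ n : ℕ, ‖f n‖ ≤ B) (M : ℕ) :
    ‖∑ m ∈ Ioc 0 M, f m * (μ m : ℂ)‖ ≤ B * M := by
  calc ‖∑ m ∈ Ioc 0 M, f m * (μ m : ℂ)‖ ≤ ∑ m ∈ Ioc 0 M, ‖f m * (μ m : ℂ)‖ := norm_sum_le _ _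
    _ ≤ ∑ _m ∈ Ioc 0 M, B := sum_le_sum fun m _ => by
        rw [norm_mul]
        calc ‖f m‖ * ‖(μ m : ℂ)‖ ≤ B * 1 :=
              mul_le_mul (hf m) (norm_moebius_cast_le_one m) (norm_nonneg _)
                ((norm_nonneg _).trans (hf m))
          _ = B := mul_one B
    _ = B * M := by rw [sum_const, Nat.card_Ioc, Nat.sub_zero, nsmul_eq_mul, mul_comm]

/-- Combining an eventual bound `‖∑_{m ≤ M} f(m) μ(m)‖ ≤ ε' M` (`M ≥ N₁`) with the trivial bound
below the threshold: `‖∑_{0 < m ≤ M} f(m) μ(m)‖ ≤ ε' M + B N₁` for every `M`. [folklore] -/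
theorem norm_sum_Ioc_le_add {f : ℕ → ℂ} {B ε' : ℝ} {N₁ : ℕ} (hε' : 0 ≤ ε')
    (hf : ∀ n : ℕ, ‖f n‖ ≤ B)
    (hN₁ : ∀ M : ℕ, N₁ ≤ M → ‖∑ m ∈ range (M + 1), f m * (μ m : ℂ)‖ ≤ ε' * M) (M : ℕ) :
    ‖∑ m ∈ Ioc 0 M, f m * (μ m : ℂ)‖ ≤ ε' * M + B * N₁ := by
  have hB : 0 ≤ B := (norm_nonneg _).trans (hf 0)
  rcases le_or_gt N₁ M with h | h
  · have h0 : f 0 * (μ 0 : ℂ) = 0 := by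
      rw [ArithmeticFunction.map_zero, Int.cast_zero, mul_zero]
    have h1 := hN₁ M h
    rw [sum_range_succ_eq_sum_Ioc (f := fun m => f m * (μ m : ℂ)) h0] at h1
    have h2 : (0 : ℝ) ≤ B * N₁ := by positivity
    linarith
  · calc ‖∑ m ∈ Ioc 0 M, f m * (μ m : ℂ)‖ ≤ B * M := norm_sum_Ioc_mul_moebius_le hf M
      _ ≤ B * N₁ := by gcongr
      _ ≤ ε' * M + B * N₁ := le_add_of_nonneg_left (by positivity)

/-- A `k`-automatic sequence (`k ≥ 2`) is bounded: it takes finitely many values. [folklore] -/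
theorem exists_norm_le {k : ℕ} (hk : 2 ≤ k) {a : ℕ → ℂ} (ha : IsAutomaticSeq k a) :
    ∃ B : ℝ, 0 ≤ B ∧ ∀ n : ℕ, ‖a n‖ ≤ B := by
  obtain ⟨B, hB⟩ := ((ha.finite_range hk).image fun z : ℂ => ‖z‖).bddAbove
  exact ⟨max B 0, le_max_right _ _, fun n =>
    (hB (Set.mem_image_of_mem (fun z : ℂ => ‖z‖) (Set.mem_range_self n))).trans (le_max_left _ _)⟩

end LiouvilleAutomatic

/-- **Automatic sequences are orthogonal to the Liouville function** (the Liouville variant of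
Müllner 2017, Thm. 1.2, derived from the Möbius statement): assuming the named fact
`mullner_moebius_automatic` (`∑_{n ≤ N} a(n) μ(n) = o(N)` for every `k`-automatic `a`, `k ≥ 2`),
for every `k ≥ 2`, every `k`-automatic `a : ℕ → ℂ` and every `ε > 0` there is `N₀` with
`‖∑_{n ≤ N} a(n) λ(n)‖ ≤ ε N` for all `N ≥ N₀`. Proof: `λ = 𝟙_□ ⋆ μ` gives
`∑_{n ≤ N} a(n) λ(n) = ∑_{d ≤ √N} ∑_{m ≤ N/d²} a(d² m) μ(m)`; the subsequences `m ↦ a(d² m)` are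
`k`-automatic, so the terms `d ≤ D` are `≤ (ε/6) N/d² + B N₁(d)` by the Möbius statement, the
terms `d > D` are trivially `≤ B N/d²`, and `∑_{d ≤ D} 1/d² ≤ 2`, `∑_{d > D} 1/d² ≤ 1/D ≤ ε/(3B)`.
[cite: Mullner2017, Thm. 1.2] -/
theorem liouville_automatic_of_mullner :
    Literature.NumberTheory.LFunctions.mullner_moebius_automatic → ∀ k : ℕ, 2 ≤ k → ∀ a : ℕ → ℂ,
      Literature.NumberTheory.LFunctions.IsAutomaticSeq k a → ∀ ε : ℝ, 0 < ε → ∃ N₀ : ℕ,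
        ∀ N : ℕ, N₀ ≤ N →
          ‖∑ n ∈ Finset.range (N + 1), a n * (ArithmeticFunction.liouville n : ℂ)‖ ≤ ε * N := by
  intro H k hk a ha ε hε
  obtain ⟨B, hB0, hB⟩ := LiouvilleAutomatic.exists_norm_le hk ha
  -- Müllner's theorem for the `k`-automatic subsequences `m ↦ a (d² m)`, at `ε / 6`
  have hsub : ∀ d : ℕ, ∃ N₁ : ℕ, ∀ M : ℕ, N₁ ≤ M →
      ‖∑ m ∈ range (M + 1), a (d * d * m) * (μ m : ℂ)‖ ≤ ε / 6 * M := by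
    intro d
    have hda : IsAutomaticSeq k (fun m => a (d * d * m)) := by
      simpa using ha.linearSubseq (d * d) 0
    exact H k hk _ hda (ε / 6) (by positivity)
  choose Nd hNd using hsub
  -- the cut-off `D` for the square parts `d²`: `B / D ≤ ε / 3`
  obtain ⟨D, hD⟩ := exists_nat_gt (3 * B / ε)
  have hD0 : 0 < D := Nat.cast_pos.mp ((by positivity : (0 : ℝ) ≤ 3 * B / ε).trans_lt hD)
  have hDpos : (0 : ℝ) < D := Nat.cast_pos.mpr hD0
  have hBD : B * (1 / (D : ℝ)) ≤ ε / 3 := by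
    rw [div_lt_iff₀ hε] at hD
    rw [mul_one_div, div_le_iff₀ hDpos]
    linarith
  -- the threshold: `B ∑_{d ≤ D} N₁(d) ≤ (ε / 3) N`
  obtain ⟨N₀, hN₀⟩ := exists_nat_ge (3 * B * (∑ d ∈ Ioc 0 D, (Nd d : ℝ)) / ε)
  refine ⟨N₀, fun N hN => ?_⟩
  have hNR : (N₀ : ℝ) ≤ N := Nat.cast_le.mpr hN
  have hBS : B * ∑ d ∈ Ioc 0 D, (Nd d : ℝ) ≤ ε / 3 * N := by
    have h := hN₀.trans hNR
    rw [div_le_iff₀ hε] at h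
    linarith
  -- `λ = 𝟙_□ ⋆ μ`
  have h0 : a 0 * (liouville 0 : ℂ) = 0 := by
    rw [ArithmeticFunction.map_zero, Int.cast_zero, mul_zero]
  rw [LiouvilleAutomatic.sum_range_succ_eq_sum_Ioc (f := fun n => a n * (liouville n : ℂ)) h0,
    LiouvilleAutomatic.sum_mul_liouville_eq]
  -- termwise bounds
  have hdiv : ∀ d : ℕ, ((N / (d * d) : ℕ) : ℝ) ≤ (N : ℝ) * (1 / (d : ℝ) ^ 2) := fun d =>
    calc ((N / (d * d) : ℕ) : ℝ) ≤ (N : ℝ) / ((d * d : ℕ) : ℝ) := Nat.cast_div_le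
      _ = (N : ℝ) * (1 / (d : ℝ) ^ 2) := by push_cast; ring
  have hT1 : ∀ d : ℕ, ‖∑ m ∈ Ioc 0 (N / (d * d)), a (d * d * m) * (μ m : ℂ)‖ ≤
      ε / 6 * N * (1 / (d : ℝ) ^ 2) + B * (Nd d : ℝ) := fun d => by
    have h1 := LiouvilleAutomatic.norm_sum_Ioc_le_add (by positivity : (0 : ℝ) ≤ ε / 6)
      (fun n => hB (d * d * n)) (hNd d) (N / (d * d))
    have h2 := mul_le_mul_of_nonneg_left (hdiv d) (by positivity : (0 : ℝ) ≤ ε / 6)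
    linarith
  have hT2 : ∀ d : ℕ, ‖∑ m ∈ Ioc 0 (N / (d * d)), a (d * d * m) * (μ m : ℂ)‖ ≤
      B * N * (1 / (d : ℝ) ^ 2) := fun d => by
    have h1 := LiouvilleAutomatic.norm_sum_Ioc_mul_moebius_le (fun n => hB (d * d * n))
      (N / (d * d))
    have h2 := mul_le_mul_of_nonneg_left (hdiv d) hB0
    linarith
  -- the terms `d ≤ D`
  have hsum1 : ∑ d ∈ Ioc 0 D, ‖∑ m ∈ Ioc 0 (N / (d * d)), a (d * d * m) * (μ m : ℂ)‖ ≤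
      ε / 6 * N * 2 + B * ∑ d ∈ Ioc 0 D, (Nd d : ℝ) := by
    calc ∑ d ∈ Ioc 0 D, ‖∑ m ∈ Ioc 0 (N / (d * d)), a (d * d * m) * (μ m : ℂ)‖
        ≤ ∑ d ∈ Ioc 0 D, (ε / 6 * N * (1 / (d : ℝ) ^ 2) + B * (Nd d : ℝ)) :=
          sum_le_sum fun d _ => hT1 d
      _ = ε / 6 * N * ∑ d ∈ Ioc 0 D, (1 / (d : ℝ) ^ 2) + B * ∑ d ∈ Ioc 0 D, (Nd d : ℝ) := by
          rw [sum_add_distrib, mul_sum, mul_sum]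
      _ ≤ ε / 6 * N * 2 + B * ∑ d ∈ Ioc 0 D, (Nd d : ℝ) := by
          have h1 := sum_Ioc_inv_sq_le_two D
          have h2 := mul_le_mul_of_nonneg_left h1 (by positivity : (0 : ℝ) ≤ ε / 6 * N)
          linarith
  -- the terms `d > D`
  have hsum2 : ∑ d ∈ Ioc D (Nat.sqrt N), ‖∑ m ∈ Ioc 0 (N / (d * d)), a (d * d * m) * (μ m : ℂ)‖ ≤
      ε / 3 * N := by
    calc ∑ d ∈ Ioc D (Nat.sqrt N), ‖∑ m ∈ Ioc 0 (N / (d * d)), a (d * d * m) * (μ m : ℂ)‖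
        ≤ ∑ d ∈ Ioc D (Nat.sqrt N), B * N * (1 / (d : ℝ) ^ 2) := sum_le_sum fun d _ => hT2 d
      _ = B * N * ∑ d ∈ Ioc D (Nat.sqrt N), (1 / (d : ℝ) ^ 2) := by rw [mul_sum]
      _ ≤ B * N * (1 / D) :=
          mul_le_mul_of_nonneg_left (sum_Ioc_inv_sq_le hD0 _) (by positivity)
      _ = B * (1 / D) * N := by ring
      _ ≤ ε / 3 * N := mul_le_mul_of_nonneg_right hBD (Nat.cast_nonneg N)
  calc ‖∑ d ∈ Ioc 0 (Nat.sqrt N), ∑ m ∈ Ioc 0 (N / (d * d)), a (d * d * m) * (μ m : ℂ)‖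
      ≤ ∑ d ∈ Ioc 0 (Nat.sqrt N), ‖∑ m ∈ Ioc 0 (N / (d * d)), a (d * d * m) * (μ m : ℂ)‖ :=
        norm_sum_le _ _
    _ ≤ ∑ d ∈ Ioc 0 D ∪ Ioc D (Nat.sqrt N),
          ‖∑ m ∈ Ioc 0 (N / (d * d)), a (d * d * m) * (μ m : ℂ)‖ := by
        refine sum_le_sum_of_subset_of_nonneg (fun d hd => ?_) (fun d _ _ => norm_nonneg _)
        rw [mem_Ioc] at hd
        rw [mem_union, mem_Ioc, mem_Ioc]
        omega
    _ = ∑ d ∈ Ioc 0 D, ‖∑ m ∈ Ioc 0 (N / (d * d)), a (d * d * m) * (μ m : ℂ)‖ +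
          ∑ d ∈ Ioc D (Nat.sqrt N), ‖∑ m ∈ Ioc 0 (N / (d * d)), a (d * d * m) * (μ m : ℂ)‖ :=
        sum_union (disjoint_left.2 fun d hd1 hd2 => by
          rw [mem_Ioc] at hd1 hd2
          omega)
    _ ≤ (ε / 6 * N * 2 + B * ∑ d ∈ Ioc 0 D, (Nd d : ℝ)) + ε / 3 * N := add_le_add hsum1 hsum2
    _ ≤ ε * N := by linarith

end Summit.QuantumAdvantage.QuantumAdvantage.Theorems.MobiusLadder
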